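import Literature.NumberTheory.EllipticCurves.LevelStructureTransport
import Literature.NumberTheory.EllipticCurves.SingularModuliGaloisStable
import Literature.NumberTheory.EllipticCurves.HeegnerPointsClassNumberProofs
import HarnessLib

/-!
# Shimura reciprocity for Heegner points of level `N`, transport form:
# `Aut(ℂ/K)` permutes the Heegner points `(𝒪_K, 𝔫, [𝔞])` of `X₀(N)` with fixed `𝔫`

Topic `NumberTheory/EllipticCurves` (complex multiplication).  Sequel of
`LevelStructureTransport.lean` (the relation `LevelTransport N σ τ τ'`: the field automorphism `σ`
of `ℂ` carries the level-`N` structure `(Λ_τ, Λ_{Nτ})` of `τ` to that of `τ'`) and of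
`SingularModuliGaloisStable.lean` (Cox (10.26): `σ(j(τ_Q)) = j(τ_{Q'})` with `disc Q' = disc Q`).
Here the level is added: for a **Heegner form** `Q = (A, B, C)` of level `N` and discriminant
`D = d_K` with `B ≡ β (mod 2N)` — the Heegner point `(𝒪_K, 𝔫, [𝔞])` of `X₀(N)`,
`𝔞 = [1, τ_Q]`, `𝔫 = ℤN + ℤθ`, `θ = (−β + √D)/2` (Gross 1984, §I.1; Gross–Kohnen–Zagier 1987,
§I.1) — and an automorphism `σ` of `ℂ` **fixing `√D`** (i.e. fixing `K ⊂ ℂ` pointwise), we prove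

* `exists_levelTransport_of_apply_sqrtDisc_eq` — **there is a Heegner form `Q'` of the same level,
  discriminant and residue `β` with `LevelTransport N σ τ_Q τ_{Q'}`**: `σ` carries the point
  `(𝒪_K, 𝔫, [𝔞])` to a point `(𝒪_K, 𝔫, [𝔟])` with the *same* `𝔫`.  This is the transport form of
  the Shimura reciprocity law for Heegner points (Darmon 2004, Thm. 3.7: `Φ_N(α ⋆ τ)` versus
  `rec(α⁻¹)`; Gross 1984, §I.1 / Gross 1991, (3.2): `x^σ = (𝒪_K, 𝔫, [𝔞𝔟⁻¹])` for
  `σ = (𝔟, H/K)`), without the identification of `[𝔟]` through the Artin map, which is not needed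
  for the Galois descent of the trace and is not available (no class field theory in Mathlib);
* `levelTransport_self_of_apply_formJ_eq` — if moreover `σ` fixes `j(τ_Q)`, then
  `LevelTransport N σ τ_Q τ_Q`: **`σ ∈ Aut(ℂ/K(j(τ_Q)))` fixes the point `(𝒪_K, 𝔫, [𝔞])` of
  `X₀(N)`** — the input "`(j(τ), j(Nτ)) ∈ X₀(N)(H)`" of Darmon 2004, Thm. 3.6, in the correct
  (moduli) form (the plane model by `Φ_N` being singular at such points in general).

## Proof (Gross 1984, §I.1 dictionary, run through `Aut(ℂ)`)

Let `Λ = ℤτ + ℤ`, `Λ_N = ℤNτ + ℤ` (`τ = τ_Q`), `θ = (−β + √D)/2`, `θ' = (−β − √D)/2`.  Because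
`N ∣ A` and `B ≡ β (mod 2N)` one checks (`inv_mul_theta_mul_mem_lattice`,
`thetaBar_mul_mem_lattice_levelPoint`): `Λ_N ⊆ Λ`, `NΛ ⊆ Λ_N`, `θΛ_N ⊆ NΛ`, `θ'Λ ⊆ Λ_N` — the
relations `𝔫·(Λ𝔫⁻¹) ⊆ Λ`, `𝔫̄Λ ⊆ N·Λ𝔫⁻¹` for `Λ_N = N·Λ𝔫⁻¹`.  With `uN + vβ = 1` (from
`gcd(N, D) = 1`, the Heegner hypothesis) they pin `Λ_N` down: `Λ_N = NΛ + θ'Λ`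
(`mem_iff_of_level_relations`, a sandwich needing no index computation).  All four relations are
inclusions `cL₁ ⊆ L₂` and are transported along `σ` (`IsTransportedBy.le/mul_mem`), `σ` fixing
`N, θ, θ'`; hence `Λ_N^σ = NΛ^σ + θ'Λ^σ` as well.  By Cox (10.26) and Thm. 10.9, `Λ^σ = cΛ_{τ₁}`
for a primitive form `Q₁` of discriminant `D`; by the surjectivity of Heegner forms onto the class
group (`exists_heegnerForm_mk0_formIdeal_eq`) and its injectivity at level one
(`isGamma0Equiv_of_span_mul_formIdeal_eq`), `Q₁` is `SL₂(ℤ)`-equivalent to a Heegner form `Q'` of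
level `N` with `B' ≡ β`, so `Λ^σ = c'Λ_{τ_{Q'}}`; and `NΛ_{τ_{Q'}} + θ'Λ_{τ_{Q'}} = Λ_{Nτ_{Q'}}` by
the same sandwich.  Therefore `(Λ^σ, Λ_N^σ) = c'(Λ_{τ_{Q'}}, Λ_{Nτ_{Q'}})`, i.e.
`LevelTransport N σ τ_Q τ_{Q'}`.  If `σ` fixes `j(τ_Q)` one may take `Q' = Q` (Thm. 10.9 directly).

Everything is proved; the only definition is `sqrtDisc D = i√|D|`.  No named facts.

## References

* B. H. Gross, *Heegner points on `X₀(N)`*, in *Modular Forms* (Durham 1983), Horwood 1984,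
  87–105, §I.1. [Gross1984]
* B. H. Gross, *Kolyvagin's work on modular elliptic curves*, LMS Lecture Note Ser. 153 (1991),
  235–256, §3, (3.2)–(3.4). [GrossLMS1991]
* B. Gross, W. Kohnen, D. Zagier, *Heegner points and derivatives of `L`-series. II*, Math. Ann.
  278 (1987), 497–562, §I.1 (Heegner forms `(A, B, C)`, `τ_Q = (−B + √D)/2A`, the ideal `𝔫`).
  [GrossKohnenZagier1987]
* H. Darmon, *Rational points on modular elliptic curves*, CBMS 101, AMS 2004, Thm. 3.6, Thm. 3.7
  (PDF pp. 43–44). [Darmon2004]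
* D. A. Cox, *Primes of the form x² + ny²*, 2nd ed., Wiley 2013, §7.B, Thm. 10.9, §10.C (10.26),
  §11.D. [Cox2013]
* G. Shimura, *Introduction to the arithmetic theory of automorphic functions*, 1971, §6.8,
  Thm. 6.31. [ShimuraIATAF1971]
-/

noncomputable section

open Complex UpperHalfPlane CongruenceSubgroup PeriodPair NumberField
open scoped MatrixGroups nonZeroDivisors

namespace Literature.NumberTheory.EllipticCurves

open Literature.NumberTheory.EllipticCurves.ModularForms
  Literature.NumberTheory.QuadraticFields.BinaryQuadraticForm
  Literature.NumberTheory.QuadraticFields.Quadratic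

universe u

/-! ### The square root `√D = i√|D|` and the numbers `θ, θ'` -/

/-- `sqrtDisc D = i√|D| ∈ ℍ`, the square root of the negative integer `D` with positive imaginary
part; for a positive definite form `Q = (A, B, C)` of discriminant `D`, `√D = 2Aτ_Q + B`
(`sqrtDisc_eq`), so that `ℚ(√D) = ℚ(τ_Q)` and `θ_β = (−β + √D)/2 = Aτ_Q + (B − β)/2`
(Gross–Kohnen–Zagier 1987, §I.1: `τ_Q = (−B + √D)/2A`). [folklore] -/
def sqrtDisc (D : ℤ) : ℂ :=
  Complex.I * (Real.sqrt (-(D : ℝ)) : ℂ)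

/-- `√D = 2Aτ_Q + B` for a positive definite form `Q = (A, B, C)` of discriminant `D < 0`.
[folklore] -/
theorem sqrtDisc_eq {D : ℤ} {Q : ℤ × ℤ × ℤ} (hA : 0 < Q.1) (hdisc : Q.2.1 ^ 2 - 4 * Q.1 * Q.2.2 = D)
    (hD : D < 0) : sqrtDisc D = 2 * (Q.1 : ℂ) * heegnerTau Q + Q.2.1 := by
  have hneg : Q.2.1 ^ 2 - 4 * Q.1 * Q.2.2 < 0 := hdisc ▸ hD
  have hroot := heegnerTau_isRoot hA hneg
  have hDR : (D : ℝ) < 0 := by exact_mod_cast hD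
  have hdiscC : (Q.2.1 : ℂ) ^ 2 - 4 * Q.1 * Q.2.2 = D := by exact_mod_cast hdisc
  have hs2 : (2 * (Q.1 : ℂ) * heegnerTau Q + Q.2.1) ^ 2 = ((D : ℝ) : ℂ) := by
    rw [ofReal_intCast, ← hdiscC]
    linear_combination (4 * (Q.1 : ℂ)) * hroot
  obtain ⟨hre, him2⟩ := re_eq_zero_and_im_sq_eq_of_sq_eq hDR hs2
  have him_pos : 0 < (2 * (Q.1 : ℂ) * heegnerTau Q + Q.2.1).im := by
    have hA' : (0 : ℝ) < Q.1 := by exact_mod_cast hA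
    have him' : (2 * (Q.1 : ℂ) * heegnerTau Q + Q.2.1).im = 2 * Q.1 * (heegnerTau Q).im := by
      simp only [add_im, mul_im, mul_re, re_ofNat, intCast_re, im_ofNat, intCast_im, mul_zero,
        zero_mul, add_zero, sub_zero, UpperHalfPlane.coe_im, UpperHalfPlane.coe_re]
    rw [him']
    exact mul_pos (mul_pos two_pos hA') (heegnerTau Q).im_pos
  have him : (2 * (Q.1 : ℂ) * heegnerTau Q + Q.2.1).im = Real.sqrt (-(D : ℝ)) := by
    rw [← Real.sqrt_sq him_pos.le, him2]
  apply Complex.ext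
  · simp [sqrtDisc, hre]
  · simp [sqrtDisc, him]

/-- `(√D)² = D`. [folklore] -/
theorem sqrtDisc_sq {D : ℤ} (hD : D < 0) : sqrtDisc D ^ 2 = D := by
  have hD' : (0 : ℝ) ≤ -(D : ℝ) := by
    have : (D : ℝ) < 0 := by exact_mod_cast hD
    linarith
  rw [sqrtDisc, mul_pow, Complex.I_sq, ← ofReal_pow, Real.sq_sqrt hD']
  push_cast
  ring

/-- An automorphism of `ℂ` fixing `√D` fixes `θ = (−β + √D)/2`. [folklore] -/
theorem ringEquiv_apply_theta {D β : ℤ} {σ : ℂ ≃+* ℂ} (hσ : σ (sqrtDisc D) = sqrtDisc D) :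
    σ ((-β + sqrtDisc D) / 2) = (-β + sqrtDisc D) / 2 := by
  rw [map_div₀, map_add, map_neg, map_intCast, hσ, map_ofNat]

/-- An automorphism of `ℂ` fixing `√D` fixes `θ' = (−β − √D)/2`. [folklore] -/
theorem ringEquiv_apply_thetaBar {D β : ℤ} {σ : ℂ ≃+* ℂ} (hσ : σ (sqrtDisc D) = sqrtDisc D) :
    σ ((-β - sqrtDisc D) / 2) = (-β - sqrtDisc D) / 2 := by
  rw [map_div₀, map_sub, map_neg, map_intCast, hσ, map_ofNat]

/-! ### A sandwich: `Λ_N = NΛ + θ'Λ` from four inclusions and `gcd(N, β, ·) = 1` -/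

/-- **The level lattice is pinned down by the `𝔫`-relations.** Let `S_N ⊆ S` be subgroups of `ℂ`
with `NS ⊆ S_N`, `θS_N ⊆ NS`, `θ'S ⊆ S_N`, where `θ + θ' = −β` and `uN + vβ = 1` for some integers
`u, v`.  Then `S_N = NS + θ'S`: for `z ∈ S_N`, `z = (uN + vβ)z = N(uz) − vθz − vθ'z` with
`θz = Nλ`, `λ ∈ S`.  (For `S = 𝔞` a proper `𝒪_K`-ideal and `S_N = N𝔞𝔫⁻¹` this is
`N𝔞𝔫⁻¹ = 𝔫̄𝔞`, `𝔫̄ = ℤN + ℤθ'`; Gross 1984, §I.1; Cox, §7.B (7.6)/Lemma 7.14 `𝔞𝔞̄ = (N(𝔞))`.)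
No index or invertibility computation is needed in this form. [folklore] -/
theorem mem_iff_of_level_relations {S S_N : Submodule ℤ ℂ} {θ θ' : ℂ} {N : ℕ} {β u v : ℤ}
    (hN : (N : ℂ) ≠ 0) (hsum : θ + θ' = -β) (huv : u * N + v * β = 1) (h1 : S_N ≤ S)
    (h2 : ∀ a ∈ S, (N : ℂ) * a ∈ S_N) (h3 : ∀ z ∈ S_N, (N : ℂ)⁻¹ * (θ * z) ∈ S)
    (h4 : ∀ b ∈ S, θ' * b ∈ S_N) (x : ℂ) :
    x ∈ S_N ↔ ∃ a ∈ S, ∃ b ∈ S, x = N * a + θ' * b := by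
  constructor
  · intro hx
    refine ⟨u * x - v * ((N : ℂ)⁻¹ * (θ * x)), ?_, -(v * x), ?_, ?_⟩
    · refine sub_mem ?_ ?_
      · rw [← zsmul_eq_mul]; exact S.smul_mem u (h1 hx)
      · rw [← zsmul_eq_mul]; exact S.smul_mem v (h3 x hx)
    · rw [← zsmul_eq_mul]; exact S.neg_mem (S.smul_mem v (h1 hx))
    · have huvC : (u : ℂ) * N + v * β = 1 := by exact_mod_cast huv
      have hθ' : θ' = -β - θ := by linear_combination hsum
      have hcancel : (N : ℂ) * ((v : ℂ) * ((N : ℂ)⁻¹ * (θ * x))) = v * (θ * x) := by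
        field_simp
      rw [mul_sub, hcancel, hθ']
      linear_combination (-x) * huvC
  · rintro ⟨a, ha, b, hb, rfl⟩
    exact add_mem (h2 a ha) (h4 b hb)

/-- The description `S_N = NS + θ'S` is compatible with homotheties: if `T = cS` then
`cS_N = {Na + θ'b : a, b ∈ T}`. [folklore] -/
theorem mem_mulLeft_iff_of_descr {S S_N T : PeriodPair} {θ' : ℂ} {N : ℕ} {c : ℂ} (hc : c ≠ 0)
    (hT : T.lattice = (S.mulLeft c hc).lattice)
    (hS : ∀ x, x ∈ S_N.lattice ↔ ∃ a ∈ S.lattice, ∃ b ∈ S.lattice, x = N * a + θ' * b) (x : ℂ) :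
    x ∈ (S_N.mulLeft c hc).lattice ↔ ∃ a ∈ T.lattice, ∃ b ∈ T.lattice, x = N * a + θ' * b := by
  rw [mem_mulLeft_lattice, hS]
  constructor
  · rintro ⟨a, ha, b, hb, hx⟩
    refine ⟨c * a, ?_, c * b, ?_, ?_⟩
    · rw [hT]; exact mul_mem_mulLeft_lattice.mpr ha
    · rw [hT]; exact mul_mem_mulLeft_lattice.mpr hb
    · have : x = c * (N * a + θ' * b) := by rw [← hx, ← mul_assoc, mul_inv_cancel₀ hc, one_mul]
      rw [this]; ring
  · rintro ⟨a, ha, b, hb, rfl⟩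
    rw [hT, mem_mulLeft_lattice] at ha hb
    exact ⟨c⁻¹ * a, ha, c⁻¹ * b, hb, by ring⟩

/-! ### The `𝔫`-relations of a Heegner form -/

section Relations

variable {N : ℕ} [NeZero N] {D β : ℤ} {Q : ℤ × ℤ × ℤ}

/-- **`θΛ_{Nτ} ⊆ NΛ_τ`** for a Heegner form `Q = (A, B, C)` of level `N`, discriminant `D < 0` and
`B ≡ β (mod 2N)`, with `θ = (−β + √D)/2 = Aτ + (B − β)/2` (so `θ·1 = N(A/N·τ + k)`,
`θ·Nτ = N((Nk − B)τ − C)`, `B − β = 2Nk`) — the relation `𝔫(N𝔞𝔫⁻¹) ⊆ N𝔞` for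
`𝔫 = ℤN + ℤθ` (Gross 1984, §I.1). [cite: Gross1984, §I.1] -/
theorem inv_mul_theta_mul_mem_lattice (hQ : Q ∈ heegnerForms N D) (hD : D < 0)
    (hβ : Q.2.1 ≡ β [ZMOD 2 * N]) :
    ∀ l ∈ (ofUpperHalfPlane (levelPoint N (heegnerTau Q))).lattice,
      (N : ℂ)⁻¹ * ((-β + sqrtDisc D) / 2 * l) ∈ (ofUpperHalfPlane (heegnerTau Q)).lattice := by
  obtain ⟨hdisc, hA, hNA, -⟩ := hQ
  obtain ⟨A', hA'⟩ := hNA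
  obtain ⟨k, hk⟩ := (Int.modEq_iff_dvd.mp hβ.symm)
  have hneg : Q.2.1 ^ 2 - 4 * Q.1 * Q.2.2 < 0 := hdisc ▸ hD
  have hroot := heegnerTau_isRoot hA hneg
  have hs := sqrtDisc_eq hA hdisc hD
  have hN0 : (N : ℂ) ≠ 0 := by exact_mod_cast NeZero.ne N
  have hAC : (Q.1 : ℂ) = N * A' := by exact_mod_cast hA'
  have hkC : (Q.2.1 : ℂ) - β = 2 * N * k := by exact_mod_cast hk
  have hroot' : (N : ℂ) * A' * (heegnerTau Q : ℂ) ^ 2 + Q.2.1 * heegnerTau Q + Q.2.2 = 0 := by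
    rw [← hAC]; exact hroot
  have hθ : (-(β : ℂ) + sqrtDisc D) / 2 = N * (A' * heegnerTau Q + k) := by
    rw [hs, hAC]; linear_combination (1 / 2 : ℂ) * hkC
  intro l hl
  obtain ⟨m, n, rfl⟩ := mem_lattice.mp hl
  refine mem_lattice.mpr ⟨-Q.2.1 * m + A' * n + k * m * N, -Q.2.2 * m + k * n, ?_⟩
  simp only [ofUpperHalfPlane_ω₁, ofUpperHalfPlane_ω₂, coe_levelPoint, mul_one]
  rw [hθ, mul_assoc (N : ℂ), ← mul_assoc (N : ℂ)⁻¹, inv_mul_cancel₀ hN0, one_mul]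
  push_cast
  linear_combination (-(m : ℂ)) * hroot'

/-- **`θ'Λ_τ ⊆ Λ_{Nτ}`** for a Heegner form of level `N`, discriminant `D < 0`, `B ≡ β (mod 2N)`,
with `θ' = (−β − √D)/2 = −Aτ − (B + β)/2` (`θ'·1 = −(A/N)Nτ − (Nk + β)`, `θ'·τ = kNτ + C`) — the
relation `𝔫̄𝔞 ⊆ N𝔞𝔫⁻¹` (Gross 1984, §I.1). [cite: Gross1984, §I.1] -/
theorem thetaBar_mul_mem_lattice_levelPoint (hQ : Q ∈ heegnerForms N D) (hD : D < 0)
    (hβ : Q.2.1 ≡ β [ZMOD 2 * N]) :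
    ∀ l ∈ (ofUpperHalfPlane (heegnerTau Q)).lattice,
      (-β - sqrtDisc D) / 2 * l ∈ (ofUpperHalfPlane (levelPoint N (heegnerTau Q))).lattice := by
  obtain ⟨hdisc, hA, hNA, -⟩ := hQ
  obtain ⟨A', hA'⟩ := hNA
  obtain ⟨k, hk⟩ := (Int.modEq_iff_dvd.mp hβ.symm)
  have hneg : Q.2.1 ^ 2 - 4 * Q.1 * Q.2.2 < 0 := hdisc ▸ hD
  have hroot := heegnerTau_isRoot hA hneg
  have hs := sqrtDisc_eq hA hdisc hD
  have hAC : (Q.1 : ℂ) = N * A' := by exact_mod_cast hA'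
  have hkC : (Q.2.1 : ℂ) - β = 2 * N * k := by exact_mod_cast hk
  have hroot' : (N : ℂ) * A' * (heegnerTau Q : ℂ) ^ 2 + Q.2.1 * heegnerTau Q + Q.2.2 = 0 := by
    rw [← hAC]; exact hroot
  have hθ' : (-(β : ℂ) - sqrtDisc D) / 2 = -((N : ℂ) * (A' * heegnerTau Q + k)) - β := by
    rw [hs, hAC]; linear_combination (-1 / 2 : ℂ) * hkC
  intro l hl
  obtain ⟨m, n, rfl⟩ := mem_lattice.mp hl
  refine mem_lattice.mpr ⟨k * m - A' * n, Q.2.2 * m - (N * k + β) * n, ?_⟩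
  simp only [ofUpperHalfPlane_ω₁, ofUpperHalfPlane_ω₂, coe_levelPoint, mul_one]
  rw [hθ']
  push_cast
  linear_combination (m : ℂ) * hroot' - (m : ℂ) * (heegnerTau Q : ℂ) * hkC

omit [NeZero N] in
/-- Bezout for the level: if `gcd(N, D) = 1` and `4N ∣ β² − D` then `uN + vβ = 1` for some
integers `u, v` (any common divisor of `N` and `β` divides `D = β² − 4N·m₀`). [folklore] -/
theorem exists_bezout_level (hND : IsCoprime (N : ℤ) D) (hβ : (4 * N : ℤ) ∣ β ^ 2 - D) :
    ∃ u v : ℤ, u * N + v * β = 1 := by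
  obtain ⟨a, b, hab⟩ := hND
  obtain ⟨m₀, hm₀⟩ := hβ
  refine ⟨a - 4 * b * m₀, b * β, ?_⟩
  have hD : D = β ^ 2 - 4 * N * m₀ := by linarith
  rw [hD] at hab
  linear_combination hab

/-- **`Λ_{Nτ} = NΛ_τ + θ'Λ_τ`** for a Heegner form of level `N`, discriminant `D < 0` with
`gcd(N, D) = 1`, and `B ≡ β (mod 2N)`, `4N ∣ β² − D`: the ideal-theoretic identity
`N𝔞𝔫⁻¹ = 𝔫̄𝔞` behind "`B mod 2N` determines `𝔫`" (Gross 1984, §I.1), by the sandwich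
`mem_iff_of_level_relations`. [cite: Gross1984, §I.1] -/
theorem mem_lattice_levelPoint_iff (hQ : Q ∈ heegnerForms N D) (hD : D < 0)
    (hND : IsCoprime (N : ℤ) D) (hβD : (4 * N : ℤ) ∣ β ^ 2 - D) (hβ : Q.2.1 ≡ β [ZMOD 2 * N])
    (x : ℂ) :
    x ∈ (ofUpperHalfPlane (levelPoint N (heegnerTau Q))).lattice ↔
      ∃ a ∈ (ofUpperHalfPlane (heegnerTau Q)).lattice, ∃ b ∈ (ofUpperHalfPlane (heegnerTau Q)).lattice,
        x = N * a + (-β - sqrtDisc D) / 2 * b := by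
  obtain ⟨u, v, huv⟩ := exists_bezout_level hND hβD
  have hN0 : (N : ℂ) ≠ 0 := by exact_mod_cast NeZero.ne N
  exact mem_iff_of_level_relations hN0 (by ring) huv (lattice_levelPoint_le _)
    (natCast_mul_mem_lattice_levelPoint _) (inv_mul_theta_mul_mem_lattice hQ hD hβ)
    (thetaBar_mul_mem_lattice_levelPoint hQ hD hβ) x

end Relations

/-! ### The engine: transport of the pair `(Λ_τ, Λ_{Nτ})` along `σ` fixing `√D` -/

section Engine

variable {N : ℕ} [NeZero N] {D β : ℤ} {σ : ℂ ≃+* ℂ} {Q Q' : ℤ × ℤ × ℤ}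

/-- **Transported level lattice.** For a Heegner form `Q` (level `N`, discriminant `D < 0`,
`gcd(N, D) = 1`, `B ≡ β (mod 2N)`, `4N ∣ β² − D`) and `σ ∈ Aut(ℂ)` fixing `√D`, the transports
`M = Λ_τ^σ`, `M_N = Λ_{Nτ}^σ` again satisfy `M_N = NM + θ'M`: the four `𝔫`-relations are
inclusions `cL₁ ⊆ L₂` with `c ∈ {1, N, θ, θ'}` fixed by `σ`, hence transported
(`IsTransportedBy.le`, `IsTransportedBy.mul_mem`), and the sandwich applies.
[cite: Gross1984, §I.1] -/
theorem mem_transport_levelPoint_iff (hQ : Q ∈ heegnerForms N D) (hD : D < 0)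
    (hND : IsCoprime (N : ℤ) D) (hβD : (4 * N : ℤ) ∣ β ^ 2 - D) (hβ : Q.2.1 ≡ β [ZMOD 2 * N])
    (hσ : σ (sqrtDisc D) = sqrtDisc D) {M M_N : PeriodPair}
    (hM : IsTransportedBy σ (ofUpperHalfPlane (heegnerTau Q)) M)
    (hMN : IsTransportedBy σ (ofUpperHalfPlane (levelPoint N (heegnerTau Q))) M_N) (x : ℂ) :
    x ∈ M_N.lattice ↔ ∃ a ∈ M.lattice, ∃ b ∈ M.lattice, x = N * a + (-β - sqrtDisc D) / 2 * b := by
  obtain ⟨u, v, huv⟩ := exists_bezout_level hND hβD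
  have hN0 : (N : ℂ) ≠ 0 := by exact_mod_cast NeZero.ne N
  refine mem_iff_of_level_relations (θ := (-β + sqrtDisc D) / 2) hN0 (by ring) huv ?_ ?_ ?_ ?_ x
  · exact hMN.le hM (lattice_levelPoint_le _)
  · have h := hM.mul_mem hMN (natCast_mul_mem_lattice_levelPoint (N := N) (heegnerTau Q))
    rwa [map_natCast] at h
  · -- `θΛ_N ⊆ NΛ`, transported to `θM_N ⊆ NM`
    have h3 : ∀ l ∈ (ofUpperHalfPlane (levelPoint N (heegnerTau Q))).lattice,
        (-β + sqrtDisc D) / 2 * l ∈ ((ofUpperHalfPlane (heegnerTau Q)).mulLeft N hN0).lattice :=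
      fun l hl ↦ mem_mulLeft_lattice.mpr (inv_mul_theta_mul_mem_lattice hQ hD hβ l hl)
    have h := hMN.mul_mem (hM.mulLeft N hN0) h3
    intro z hz
    have hz' := h z hz
    rw [ringEquiv_apply_theta hσ, mem_mulLeft_lattice, map_natCast] at hz'
    exact hz'
  · have h := hM.mul_mem hMN (thetaBar_mul_mem_lattice_levelPoint hQ hD hβ)
    rwa [ringEquiv_apply_thetaBar hσ] at h

/-- **The engine.** Let `Q, Q'` be Heegner forms of level `N`, discriminant `D < 0`
(`gcd(N, D) = 1`) with `B ≡ B' ≡ β (mod 2N)`, `4N ∣ β² − D`, and `σ ∈ Aut(ℂ)` fixing `√D`.  If the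
transport `Λ_{τ_Q}^σ` is homothetic to `Λ_{τ_{Q'}}`, then `σ` transports the whole level-`N`
structure: `LevelTransport N σ τ_Q τ_{Q'}` — because `Λ_{Nτ}^σ = NΛ^σ + θ'Λ^σ` and
`Λ_{Nτ'} = NΛ_{τ'} + θ'Λ_{τ'}` with the same `θ'`. (Gross 1984, §I.1: the Heegner points with fixed
`𝔫` are the `(𝒪, 𝔫, [𝔞])`; Darmon 2004, Thm. 3.7.) [cite: Gross1984, §I.1] -/
theorem levelTransport_of_transport_lattice_eq (hD : D < 0) (hND : IsCoprime (N : ℤ) D)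
    (hβD : (4 * N : ℤ) ∣ β ^ 2 - D) (hσ : σ (sqrtDisc D) = sqrtDisc D)
    (hQ : Q ∈ heegnerForms N D) (hβ : Q.2.1 ≡ β [ZMOD 2 * N])
    (hQ' : Q' ∈ heegnerForms N D) (hβ' : Q'.2.1 ≡ β [ZMOD 2 * N])
    {M : PeriodPair} (hM : IsTransportedBy σ (ofUpperHalfPlane (heegnerTau Q)) M)
    {c : ℂ} (hc : c ≠ 0) (hMc : M.lattice = ((ofUpperHalfPlane (heegnerTau Q')).mulLeft c hc).lattice) :
    LevelTransport N σ (heegnerTau Q) (heegnerTau Q') := by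
  obtain ⟨M_N, hMN⟩ := exists_isTransportedBy σ (ofUpperHalfPlane (levelPoint N (heegnerTau Q)))
  refine levelTransport_of_isTransportedBy hM hMN hc hMc ?_
  ext x
  rw [mem_transport_levelPoint_iff hQ hD hND hβD hβ hσ hM hMN x,
    mem_mulLeft_iff_of_descr hc hMc (mem_lattice_levelPoint_iff hQ' hD hND hβD hβ')]

/-- **`Aut(ℂ/K(j(τ_Q)))` fixes the Heegner point `(𝒪_K, 𝔫, [𝔞])` of `X₀(N)`.** If `σ ∈ Aut(ℂ)`
fixes `√D` and `j(τ_Q)` for a Heegner form `Q` (level `N`, discriminant `D < 0`, `gcd(N, D) = 1`,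
`B ≡ β (mod 2N)`, `4N ∣ β² − D`), then `σ` transports the level-`N` structure of `τ_Q` to itself:
`Λ^σ` has `j`-invariant `σ(j(Λ)) = j(Λ)`, hence is homothetic to `Λ` (Cox, Thm. 10.9), and the
engine applies with `Q' = Q`.  This is the moduli form of the step "`(j(τ), j(Nτ)) ∈ X₀(N)(H)`"
in Darmon 2004, proof of Thm. 3.6. [cite: Darmon2004, Thm. 3.6 (PDF p. 43)] -/
theorem levelTransport_self_of_apply_formJ_eq (hD : D < 0) (hND : IsCoprime (N : ℤ) D)
    (hβD : (4 * N : ℤ) ∣ β ^ 2 - D) (hσ : σ (sqrtDisc D) = sqrtDisc D)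
    (hQ : Q ∈ heegnerForms N D) (hβ : Q.2.1 ≡ β [ZMOD 2 * N]) (hj : σ (formJ Q) = formJ Q) :
    LevelTransport N σ (heegnerTau Q) (heegnerTau Q) := by
  obtain ⟨M, hM⟩ := exists_isTransportedBy σ (ofUpperHalfPlane (heegnerTau Q))
  have hjM : (ofUpperHalfPlane (heegnerTau Q)).j = M.j := by
    rw [hM.j_eq, ← formJ_def, hj, formJ_def]
  obtain ⟨c, hc, hMc⟩ := exists_lattice_eq_mulLeft_of_j_eq hjM
  exact levelTransport_of_transport_lattice_eq hD hND hβD hσ hQ hβ hQ hβ hM hc hMc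

end Engine

/-! ### Every class of discriminant `d_K` contains a Heegner form with prescribed `β` -/

section ClassGroup

variable {K : Type u} [Field K] [NumberField K]

/-- **Every primitive positive definite form of discriminant `d_K` is `SL₂(ℤ)`-equivalent to a
Heegner form of level `N` with `B ≡ β (mod 2N)`** (given `β² ≡ d_K (mod 4N)`), stated through the
`j`-invariant: `j(τ_{Q'}) = j(τ_{Q₁})`.  Surjectivity of `[Q] ↦ [𝔞_Q]` from Heegner forms with
fixed `β` onto `Cl(K)` (the tree's `exists_heegnerForm_mk0_formIdeal_eq`; Gross 1984, §I.1:
the points `(𝒪, 𝔫, [𝔞])` run over all of `Pic(𝒪_K)`) combined with its injectivity at level one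
(`isGamma0Equiv_of_span_mul_formIdeal_eq` with `N = 1`; Cox, Thm. 7.7(ii)) and the
`SL₂(ℤ)`-invariance of `j`. [cite: Gross1984, §I.1] -/
theorem exists_heegnerForm_formJ_eq (hK : IsImaginaryQuadratic K) {N : ℕ} [NeZero N] {β : ℤ}
    (hβ : (4 * N : ℤ) ∣ β ^ 2 - NumberField.discr K) {Q₁ : ℤ × ℤ × ℤ} (hA₁ : 0 < Q₁.1)
    (hprim : IsPrimitive Q₁) (hdisc : discr Q₁ = NumberField.discr K) :
    ∃ Q' ∈ heegnerForms N (NumberField.discr K), Q'.2.1 ≡ β [ZMOD 2 * N] ∧ formJ Q' = formJ Q₁ := by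
  classical
  obtain ⟨b, hb⟩ := exists_basis_zero_eq_one hK.1
  set t : ℤ := b.repr (b 1 * b 1) 1 with ht
  set m : ℤ := b.repr (b 1 * b 1) 0 with hm
  have hω : b 1 * b 1 = (m : 𝓞 K) + (t : 𝓞 K) * b 1 := basis_one_mul_self_eq b hb
  have hD : NumberField.discr K = t ^ 2 + 4 * m := discr_eq_sq_add_four_mul b hb
  have hneg : t ^ 2 + 4 * m < 0 := hD ▸ hK.discr_neg
  have hβ' : (4 * N : ℤ) ∣ β ^ 2 - (t ^ 2 + 4 * m) := hD ▸ hβ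
  -- `Q₁` as a level-one Heegner form
  have hdisc₁ : Q₁.2.1 ^ 2 - 4 * Q₁.1 * Q₁.2.2 = t ^ 2 + 4 * m := hD ▸ hdisc
  have hQ₁1 : Q₁ ∈ heegnerForms 1 (t ^ 2 + 4 * m) :=
    ⟨hdisc₁, hA₁, by simp, (BinQF.isPrimitive_iff _).mp ((isPrimitive_iff_binQF Q₁).mp hprim)⟩
  have h01 : Ideal.span {(Q₁.1 : 𝓞 K), b 1 - (((Q₁.2.1 + t) / 2 : ℤ) : 𝓞 K)} ∈ (Ideal (𝓞 K))⁰ :=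
    span_pair_mem_nonZeroDivisors b hb hA₁.ne' _
  obtain ⟨Q', hQ', hβQ', h0', hc⟩ :=
    exists_heegnerForm_mk0_formIdeal_eq b hb hω hneg hβ' (ClassGroup.mk0 ⟨_, h01⟩)
  obtain ⟨x, y, hx, -, hxy⟩ := ClassGroup.mk0_eq_mk0_iff.mp hc
  obtain ⟨hdisc', hA', hNA', hprim'⟩ := hQ'
  have hQ'1 : Q' ∈ heegnerForms 1 (t ^ 2 + 4 * m) := ⟨hdisc', hA', by simp, hprim'⟩
  -- `B' ≡ B₁ (mod 2)`: both are `≡ t`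
  have hBB : Q'.2.1 ≡ Q₁.2.1 [ZMOD 2 * (1 : ℕ)] := by
    have h2k' := two_mul_ediv_two_of_disc_eq hdisc'
    have h2k₁ := two_mul_ediv_two_of_disc_eq hdisc₁
    rw [Nat.cast_one, mul_one]
    exact Int.modEq_iff_dvd.mpr ⟨(Q₁.2.1 + t) / 2 - (Q'.2.1 + t) / 2, by linarith⟩
  have hequiv : IsGamma0Equiv 1 Q' Q₁ :=
    isGamma0Equiv_of_span_mul_formIdeal_eq (N := 1) b hb hω hneg hQ'1 hQ₁1 hBB hx hxy
  obtain ⟨γ, hγ⟩ := hequiv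
  refine ⟨Q', ⟨hD ▸ hdisc', hA', hNA', hprim'⟩, hβQ', ?_⟩
  rw [formJ_def, formJ_def, ← kleinJ_eq_periodPair_j, ← kleinJ_eq_periodPair_j, ← hγ,
    Subgroup.smul_def, kleinJ_smul]

end ClassGroup

/-! ### The transport theorem: `Aut(ℂ/K)` permutes the Heegner points with fixed `𝔫` -/

section Main

variable {K : Type u} [Field K] [NumberField K] {N : ℕ} [NeZero N]

/-- **Shimura reciprocity for Heegner points of level `N`, transport form.** Let `K` be an
imaginary quadratic field with `gcd(N, d_K) = 1` (e.g. under the Heegner hypothesis,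
`SatisfiesHeegnerHypothesis.coprime_discr`), `β² ≡ d_K (mod 4N)`, `σ` an automorphism of `ℂ`
fixing `√d_K = i√|d_K|` (i.e. fixing `K ⊂ ℂ` pointwise), and `Q` a Heegner form of level `N`,
discriminant `d_K` with `B ≡ β (mod 2N)`.  Then there is a Heegner form `Q'` of the same level,
discriminant and residue `β` such that `σ` carries the level-`N` structure `(Λ_{τ_Q}, Λ_{Nτ_Q})` to
`(Λ_{τ_{Q'}}, Λ_{Nτ_{Q'}})` up to a common homothety (`LevelTransport N σ τ_Q τ_{Q'}`), i.e.
`(E_{τ_Q}, C_{τ_Q})^σ ≅ (E_{τ_{Q'}}, C_{τ_{Q'}})`.  In the language of Gross 1984, §I.1 and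
Gross 1991, (3.4): `σ ∈ Aut(ℂ/K)` carries the Heegner point `(𝒪_K, 𝔫, [𝔞])` of `X₀(N)` to a
Heegner point `(𝒪_K, 𝔫, [𝔟])` with the same `𝔫` (there `[𝔟] = [𝔞𝔠⁻¹]` for `σ|_H = (𝔠, H/K)`,
the Artin symbol, which is not identified here); Darmon 2004, Thm. 3.7 (Shimura reciprocity law):
"`Φ_N(α ⋆ τ) = rec(α⁻¹)Φ_N(τ)`".  `Q'` is unique up to `Γ₀(N)`
(`LevelTransport.exists_gamma0_smul_eq_right`).
[cite: Darmon2004, Thm. 3.7 (PDF p. 44)] [cite: Gross1984, §I.1] -/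
theorem exists_levelTransport_of_apply_sqrtDisc_eq (hK : IsImaginaryQuadratic K)
    (hND : IsCoprime (N : ℤ) (NumberField.discr K)) {β : ℤ}
    (hβD : (4 * N : ℤ) ∣ β ^ 2 - NumberField.discr K) {σ : ℂ ≃+* ℂ}
    (hσ : σ (sqrtDisc (NumberField.discr K)) = sqrtDisc (NumberField.discr K))
    {Q : ℤ × ℤ × ℤ} (hQ : Q ∈ heegnerForms N (NumberField.discr K))
    (hβ : Q.2.1 ≡ β [ZMOD 2 * N]) :
    ∃ Q' ∈ heegnerForms N (NumberField.discr K), Q'.2.1 ≡ β [ZMOD 2 * N] ∧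
      LevelTransport N σ (heegnerTau Q) (heegnerTau Q') := by
  have hD : NumberField.discr K < 0 := hK.discr_neg
  obtain ⟨M, hM⟩ := exists_isTransportedBy σ (ofUpperHalfPlane (heegnerTau Q))
  -- Cox (10.26): `σ(j(τ_Q)) = j(τ_{Q₁})`, `disc Q₁ = d_K`
  have hQ' := hQ
  obtain ⟨hdisc, hA, -, hprim⟩ := hQ'
  have hprimQ : IsPrimitive Q := (isPrimitive_iff_binQF Q).mpr ((BinQF.isPrimitive_iff _).mpr hprim)
  have hdiscQ : discr Q = NumberField.discr K := hdisc
  obtain ⟨Q₁, hA₁, hprim₁, hdisc₁, hσj⟩ :=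
    exists_formJ_eq_ringEquiv_apply hA hprimQ (by rw [hdiscQ]; exact hD) σ
  -- a Heegner form `Q'` with `B' ≡ β` in the class of `Q₁`
  obtain ⟨Q', hQ', hβ', hj'⟩ :=
    exists_heegnerForm_formJ_eq hK hβD hA₁ hprim₁ (hdisc₁.trans hdiscQ)
  -- `Λ^σ` is homothetic to `Λ_{τ_{Q'}}`
  have hjM : (ofUpperHalfPlane (heegnerTau Q')).j = M.j := by
    rw [hM.j_eq, ← formJ_def, ← formJ_def, hσj, hj']
  obtain ⟨c, hc, hMc⟩ := exists_lattice_eq_mulLeft_of_j_eq hjM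
  exact ⟨Q', hQ', hβ', levelTransport_of_transport_lattice_eq hD hND hβD hσ hQ hβ hQ' hβ' hM hc hMc⟩

end Main

end Literature.NumberTheory.EllipticCurves

end
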